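import Mathlib
import Summits.ValiantsHypothesis.ValiantsHypothesis.Theorems.LiouvilleSarnakLiouvilleCutRankTwoAdicTwin

/-!
# Route LiouvilleSarnak — crux `LiouvilleCutRank` (stmt-ValiantsHypothesis-14775): the two-adic twin on an
# ARBITRARY cut has rank `≤ n + 1`

`Theorems/LiouvilleSarnakLiouvilleCutRankTwoAdicTwin.lean` (p830177): the two-adic sign `f₀(m) = (-1)^{v₂(m)}` — the
simplest completely multiplicative `2`-automatic twin of `λ` with `f₀(2) = λ(2)` — has cut rank `≥ n + 1` on the
bit-interleaving cut `(CR)^n` and `≤ 2` on the aligned cut.  This file closes the bracket from above for EVERY cut: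

* `twoAdicSign_ofBits_succ_congr` — the sign `f₀(N + 1)` of a bit vector is decided by the bits up to any zero bit;
* ★ `rank_twoAdicSign_le_succ` — for every level `n` and EVERY cut `π` (balanced square case of the crux's format), the
  cut matrix `(f₀(N_π(r,c) + 1))_{r,c}` has rank `≤ n + 1`: a row enters only through the position of its first zero row
  bit (or through being all ones), so there are at most `n + 1` distinct rows.

So the two-adic twin's cut rank is always between `1` and `n + 1` — logarithmic in the dimension `2^n` and maximal
exactly on finely interleaved words — while `λ`'s cut matrices are numerically nonsingular (rank `2^n`) on every tested
word (item evidence, leafhand-2 g6).  Honest framing: a calibration of the multiplicative landscape of the residual class;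
nothing here is a case of the crux; `LiouvilleCutRank`, `DigitalBilinearLiouville`, `AlgebraicSarnak` stay OPEN; nothing
bears on `VP ≠ VNP`.  No definitions.
-/

set_option linter.dupNamespace false

noncomputable section

namespace Summit.ValiantsHypothesis.ValiantsHypothesis.Theorems.LiouvilleSarnakLiouvilleCutRank.TwoAdicTwinAllCuts

open Finset

open Summit.ValiantsHypothesis.ValiantsHypothesis.Theorems.LiouvilleSarnakLiouvilleCutRank.TwoAdicTwin
  (twoAdicSign_ofBits_succ)

/-- **Agreement up to a zero bit decides the two-adic sign.**  If `g p = false` and `g, g'` agree at all positions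
`≤ p`, then `f₀(ofBits g + 1) = f₀(ofBits g' + 1)` (both equal `(-1)^t`, `t` the first zero of `g`, which is `≤ p`).
[folklore] -/
theorem twoAdicSign_ofBits_succ_congr {L : ℕ} (g g' : Fin L → Bool) (p : Fin L) (hp : g p = false)
    (hagree : ∀ j : Fin L, (j : ℕ) ≤ p → g j = g' j) :
    (-1 : ℂ) ^ ((Nat.ofBits g + 1).factorization 2) = (-1 : ℂ) ^ ((Nat.ofBits g' + 1).factorization 2) := by
  classical
  have hex : ∃ t, ∃ h : t < L, g ⟨t, h⟩ = false := ⟨p, p.isLt, hp⟩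
  obtain ⟨htL, ht0⟩ := Nat.find_spec hex
  have hmin : ∀ j : Fin L, (j : ℕ) < Nat.find hex → g j = true := by
    intro j hj
    by_contra h
    rw [Bool.not_eq_true] at h
    exact Nat.find_min hex hj ⟨j.isLt, h⟩
  have htp : Nat.find hex ≤ p := Nat.find_min' hex ⟨p.isLt, hp⟩
  have h1 : ∀ j : Fin L, (j : ℕ) = Nat.find hex → g j = false := by
    intro j hj
    have : j = ⟨Nat.find hex, htL⟩ := Fin.ext hj
    rw [this]; exact ht0
  rw [twoAdicSign_ofBits_succ (R := ℂ) g (Nat.find hex) htL.le hmin h1,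
    twoAdicSign_ofBits_succ (R := ℂ) g' (Nat.find hex) htL.le
      (fun j hj => by rw [← hagree j (by omega)]; exact hmin j hj)
      (fun j hj => by rw [← hagree j (by omega)]; exact h1 j hj)]

/-- ★ **The two-adic twin has cut rank `≤ n + 1` on EVERY cut.**  For every level `n` and every cut `π` of the `2n`
bit positions into `n` row bits and `n` column bits, the cut matrix of `f₀(m) = (-1)^{v₂(m)}` has rank at most `n + 1`:
two rows whose first zero row bit (in the order of bit positions) is the same row index coincide, so together with the
all-ones row there are at most `n + 1` distinct rows. [this file] -/
theorem rank_twoAdicSign_le_succ (n : ℕ) (π : Fin n ⊕ Fin n ≃ Fin (2 * n)) :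
    (Matrix.of fun r c : Fin n → Bool =>
      (-1 : ℂ) ^ ((Nat.ofBits (fun k : Fin (2 * n) => Sum.elim r c (π.symm k)) + 1).factorization 2)).rank ≤
      n + 1 := by
  classical
  set M := (Matrix.of fun r c : Fin n → Bool =>
      (-1 : ℂ) ^ ((Nat.ofBits (fun k : Fin (2 * n) => Sum.elim r c (π.symm k)) + 1).factorization 2)) with hM
  -- rank ≤ number of distinct rows
  have hrk : M.rank ≤ (Finset.univ.image fun r => M r).card := by
    rw [Matrix.rank_eq_finrank_span_row]
    have hrange : Set.range M.row = ((Finset.univ.image fun r => M r : Finset ((Fin n → Bool) → ℂ)) :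
        Set ((Fin n → Bool) → ℂ)) := by
      ext v
      simp [Matrix.row]
    rw [hrange]
    exact finrank_span_finset_le_card _
  refine hrk.trans ?_
  -- the classes: for each row index `i`, the rows whose first zero (in position order) is `i`
  let pos : Fin n → ℕ := fun i => (π (Sum.inl i) : ℕ)
  let C : Fin n → Finset (Fin n → Bool) := fun i =>
    Finset.univ.filter fun r => r i = false ∧ ∀ i', pos i' < pos i → r i' = true
  have hcover : (Finset.univ.image fun r => M r) ⊆
      insert (M (fun _ => true)) (Finset.univ.biUnion fun i => (C i).image fun r => M r) := by
    intro v hv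
    obtain ⟨r, -, rfl⟩ := Finset.mem_image.mp hv
    rw [Finset.mem_insert, Finset.mem_biUnion]
    by_cases hall : ∀ i, r i = true
    · left
      have : r = fun _ => true := funext hall
      rw [this]
    · right
      obtain ⟨i₁, hi₁⟩ := not_forall.mp hall
      rw [Bool.not_eq_true] at hi₁
      obtain ⟨i, hi, hmin⟩ := Finset.exists_min_image (Finset.univ.filter fun i => r i = false) pos
        ⟨i₁, by simpa using hi₁⟩
      refine ⟨i, Finset.mem_univ _, Finset.mem_image.mpr ⟨r, ?_, rfl⟩⟩
      simp only [Finset.mem_filter, Finset.mem_univ, true_and] at hi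
      simp only [C, Finset.mem_filter, Finset.mem_univ, true_and]
      refine ⟨hi, fun i' hi' => ?_⟩
      by_contra h
      rw [Bool.not_eq_true] at h
      have := hmin i' (by simpa using h)
      omega
  -- each class carries one row pattern
  have hone : ∀ i, ((C i).image fun r => M r).card ≤ 1 := by
    intro i
    refine Finset.card_le_one.mpr ?_
    intro v hv v' hv'
    obtain ⟨r, hr, rfl⟩ := Finset.mem_image.mp hv
    obtain ⟨r', hr', rfl⟩ := Finset.mem_image.mp hv'
    simp only [C, Finset.mem_filter, Finset.mem_univ, true_and] at hr hr'
    funext c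
    simp only [hM, Matrix.of_apply]
    apply twoAdicSign_ofBits_succ_congr _ _ (π (Sum.inl i))
    · simp [hr.1]
    · intro j hj
      rcases h : π.symm j with i' | i'
      · have hj' : π (Sum.inl i') = j := by rw [← h, Equiv.apply_symm_apply]
        simp only [Sum.elim_inl]
        by_cases hlt : (j : ℕ) < pos i
        · rw [hr.2 i' (by simp only [pos]; rw [hj']; exact hlt), hr'.2 i' (by simp only [pos]; rw [hj']; exact hlt)]
        · have hji : j = π (Sum.inl i) := Fin.ext (by simp only [pos] at hj hlt ⊢; omega)
          have hii : i' = i := by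
            have : Sum.inl i' = (Sum.inl i : Fin n ⊕ Fin n) := by
              rw [← h, hji, Equiv.symm_apply_apply]
            exact Sum.inl_injective this
          rw [hii, hr.1, hr'.1]
      · simp only [Sum.elim_inr]
  calc (Finset.univ.image fun r => M r).card
      ≤ (insert (M (fun _ => true)) (Finset.univ.biUnion fun i => (C i).image fun r => M r)).card :=
        Finset.card_le_card hcover
    _ ≤ (Finset.univ.biUnion fun i => (C i).image fun r => M r).card + 1 := Finset.card_insert_le _ _
    _ ≤ (∑ i : Fin n, ((C i).image fun r => M r).card) + 1 := by
        gcongr; exact Finset.card_biUnion_le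
    _ ≤ (∑ _i : Fin n, 1) + 1 := by gcongr with i; exact hone i
    _ = n + 1 := by simp

end Summit.ValiantsHypothesis.ValiantsHypothesis.Theorems.LiouvilleSarnakLiouvilleCutRank.TwoAdicTwinAllCuts
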